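import Summits.CriticalPhenomena.CardyFormulaZ2.Theses.UnionJackBeffara
import Literature.Probability.Percolation.UnionJackSeparating
import Literature.Probability.Percolation.SmirnovReflection

/-!
# Vocabulary of line `registered` (birth skeleton) for crux `UnionJackMorera` (stmt-CriticalPhenomena-4558)

Route `UnionJackBeffara` (sub-problem `CriticalPhenomena/CardyFormulaZ2`), crux
`Summit.CriticalPhenomena.CardyFormulaZ2.Theses.UnionJackBeffara.UnionJackMorera` (item
stmt-CriticalPhenomena-4558, shared verbatim with route `DWavePairKernel`). This file is the
**definitions module** of the checked skeleton `Cruxes/UnionJackMorera/Lines/birth.lean` (planner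
`planner-skel-stmt-CriticalPhenomena-4558-0`, lead `prover-line-stmt-CriticalPhenomena-4558-0`,
`ledger skeleton check` OK 2026-08-17, two registered stubs `stub_ujSeparatingData`,
`stub_ujDiscreteMorera`): it carries, sorry-free, the skeleton's two HYPOTHESIS BUNDLES

* `UJApprox R T` — a family `T : ℝ → MarkedDomain 3` approximates the 3-marked domain
  `(Ω; a′, b′, c′) = forgetLast R` as `δ → 0⁺` (same-label arcs mutually `ε(δ)`-close, `ε → 0`;
  compacta of `Ω` eventually inside `(T δ).carrier`) — Bollobás–Riordan's (18)/(31) and p. 199 for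
  their `G_δ^∓`, as a continuum predicate;
* `IsUJDataRSW R T S` — the fields `dense`, `interior`, `equicontinuous`, `boundary` of the tree's
  `Literature.Probability.Percolation.IsSeparatingData R ω S f` (`SmirnovSeparatingData.lean`),
  VERBATIM, for the `G_s` separating probabilities `f δ i = ujSepProbFun (T δ) δ i`
  (`UnionJackSeparating.lean`) sampled on the finite sets `S δ`,

in the skeleton's own namespace, so that the stub helper files
`Theorems/UnionJackBeffaraUnionJackMorera<StubName>.lean` (each proving
`theorem <stubName> : <signature>` by name, `--supports stmt-CriticalPhenomena-4558`) and the closing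
skeleton file share ONE copy of each predicate (the registered stub signatures mention both by their
short names). Nothing in this file is asserted: both are `Prop`-valued predicates taken as hypotheses /
proved as conclusions by the registered stubs; the only theorem is the elementary non-vacuity remark
`ujApprox_const` (the constant family approximates), copied from the skeleton's closing `example`.

Sources: B. Bollobás, O. Riordan, *Percolation*, CUP (2006), Ch. 7: (18) p. 183, (31)–(34)
pp. 196–197, Claims 22–23 pp. 197–201, p. 199; V. Beffara, *Is critical 2D percolation universal?*,
Progr. Probab. 60 (2008), arXiv:0708.3908, §3–§4.
-/

noncomputable section

open Set Filter Topology Metric MeasureTheory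
open Literature.Probability.LatticeModels Literature.Probability.Percolation
open Literature.Probability.RandomPlanarGeometry Literature.Probability.RandomPlanarGeometry.MarkedDomain

namespace Summit.CriticalPhenomena.CardyFormulaZ2.Cruxes.UnionJackMorera.Birth

/-- **Approximating families of 3-marked domains.** `T : ℝ → MarkedDomain 3` approximates the
3-marked domain `(Ω; a′, b′, c′) = forgetLast R` as `δ → 0⁺`: (i) for each label `i` the arc
`(T δ).arc i` and the arc `(forgetLast R).arc i` are mutually `ε(δ)`-close, `ε → 0` (Bollobás–Riordan
(18)/(29)/(31) for their `G_δ^∓`; this pins the cyclic orientation of the marks of `T δ` to that of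
`R`, and keeps `∂(T δ)` inside the `ε(δ)`-collar of `∂Ω`); (ii) every compactum of `Ω` lies in
`(T δ).carrier` eventually (p. 199, "`C_δ ⊆ G_δ⁻`"). Inner approximations (`T δ ⊆ Ω`) and outer
ones (`Ω ⊆ T δ`) both qualify; so does the constant family `T δ = forgetLast R` (`ujApprox_const`).
A hypothesis bundle of the line `registered` of crux `UnionJackMorera`, not a fact.
(Bollobás–Riordan 2006, Ch. 7 (18) p. 183, (31) p. 196, p. 199.) -/
def UJApprox (R : ConformalRectangle) (T : ℝ → MarkedDomain 3) : Prop :=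
  (∃ ε : ℝ → ℝ, Tendsto ε (𝓝[>] 0) (𝓝 0) ∧ ∀ᶠ δ in 𝓝[>] (0 : ℝ), ∀ i : Fin 3,
      (∀ z ∈ (forgetLast R).arc i, ∃ y ∈ (T δ).arc i, dist z y ≤ ε δ) ∧
        ∀ y ∈ (T δ).arc i, ∃ z ∈ (forgetLast R).arc i, dist y z ≤ ε δ) ∧
    ∀ K : Set ℂ, IsCompact K → K ⊆ R.carrier → ∀ᶠ δ in 𝓝[>] (0 : ℝ), K ⊆ (T δ).carrier

/-- **The RSW half of Smirnov's discrete separating data on `G_s`**: the fields `dense`,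
`interior`, `equicontinuous`, `boundary` of the tree's `IsSeparatingData R ω S f`
(`SmirnovSeparatingData.lean`), VERBATIM, for the `G_s` separating probabilities
`f δ i = ujSepProbFun (T δ) δ i` of the domains `T δ` sampled on the finite sets `S δ ⊆ ℂ`
(Bollobás–Riordan (31)/(34) density, p. 199 interior face centres, proof of Claim 22 p. 198,
proof of Claim 23 pp. 200–201). The two remaining fields of `IsSeparatingData` are `mem_Icc`
(automatic: `ujSepProbFun_mem_Icc`) and `cauchy` (= the stub `stub_ujDiscreteMorera`). A
hypothesis bundle of the line `registered` of crux `UnionJackMorera`, not a fact.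
(Bollobás–Riordan 2006, Ch. 7 (31)–(34) pp. 196–197, Claims 22–23 pp. 197–201.) -/
structure IsUJDataRSW (R : ConformalRectangle) (T : ℝ → MarkedDomain 3) (S : ℝ → Finset ℂ) :
    Prop where
  /-- (31), (34): `S_δ` is `ε(δ)`-dense in `closure Ω`, `ε(δ) → 0`. -/
  dense : ∃ ε : ℝ → ℝ, Tendsto ε (𝓝[>] 0) (𝓝 0) ∧
    ∀ᶠ δ in 𝓝[>] (0 : ℝ), ∀ z ∈ closure R.carrier, ∃ w ∈ S δ, dist z w ≤ ε δ
  /-- p. 199: `S_δ` eventually contains the sample points `δ · hexCenter x` of a given compact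
  `K ⊆ Ω` (the points at which the discrete contour integrals of `stub_ujDiscreteMorera` read
  `f_δ`). -/
  interior : ∀ K : Set ℂ, IsCompact K → K ⊆ R.carrier →
    ∀ᶠ δ : ℝ in 𝓝[>] 0, ∀ x : HexVertex,
      (δ : ℂ) * hexCenter x ∈ K → (δ : ℂ) * hexCenter x ∈ S δ
  /-- Proof of Claim 22, p. 198, on `G_s`: approximate equicontinuity of `H^δ_i` on `S_δ`. -/
  equicontinuous : ∀ β > (0 : ℝ), ∃ η > (0 : ℝ), ∀ᶠ δ in 𝓝[>] (0 : ℝ), ∀ (i : Fin 3),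
    ∀ z ∈ S δ, ∀ w ∈ S δ, dist z w < η →
      ujSepProbFun (T δ) δ i z - ujSepProbFun (T δ) δ i w ≤ β
  /-- Proof of Claim 23, pp. 200–201, on `G_s`: boundary behaviour on the open arcs of
  `(Ω; a′, b′, c′)`: `H^δ_i(z_δ) → 0`, `H^δ_{i+1}(z_δ) + H^δ_{i+2}(z_δ) → 1` along sample points
  `z_δ → z ∈ A_i`. -/
  boundary : ∀ (i : Fin 3), ∀ z ∈ (forgetLast R).boundary ''
      Ioo ((forgetLast R).mark i) ((forgetLast R).nextMark i),
    ∃ zs : ℝ → ℂ, (∀ᶠ δ in 𝓝[>] (0 : ℝ), zs δ ∈ S δ ∧ zs δ ∈ R.carrier) ∧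
      Tendsto zs (𝓝[>] 0) (𝓝 z) ∧
        Tendsto (fun δ => ujSepProbFun (T δ) δ i (zs δ)) (𝓝[>] 0) (𝓝 0) ∧
          Tendsto (fun δ => ujSepProbFun (T δ) δ (i + 1) (zs δ) +
            ujSepProbFun (T δ) δ (i + 2) (zs δ)) (𝓝[>] 0) (𝓝 1)

/-- **Non-vacuity of `UJApprox`**: the constant family `T δ = forgetLast R` approximates `R`
(with `ε = 0`; compacta of `Ω` lie in `Ω = (forgetLast R).carrier`). Elementary; it is the
skeleton's closing `example`. -/
theorem ujApprox_const : ∀ R : ConformalRectangle, UJApprox R (fun _ => forgetLast R) := by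
  intro R
  refine ⟨⟨fun _ => 0, tendsto_const_nhds, Eventually.of_forall fun δ i => ?_⟩, ?_⟩
  · exact ⟨fun z hz => ⟨z, hz, by simp⟩, fun y hy => ⟨y, hy, by simp⟩⟩
  · intro K _ hK
    exact Eventually.of_forall fun δ => by simpa using hK

end Summit.CriticalPhenomena.CardyFormulaZ2.Cruxes.UnionJackMorera.Birth

/-! ## Vocabulary of the ALT line `defect_sum` (strategist D2, adopted by the lead at the cycle-1 boundary)

The Morera stub of line `birth` re-cut along Beffara's identity (discr) on Beffara's trivalent `4.8.8`
face graph `T_s` (balanced centres `ujFaceCenter`): rotation defect, face sets, interior defect sum,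
boundary flux sum, solid lattice triangles and the orientation bookkeeping `ShiftMatches` — verbatim the
text of `Cruxes/UnionJackMorera/Lines/defect_sum.lean` (planner-cstrat-stmt-CriticalPhenomena-4558-s2-0,
2026-08-17), in that skeleton's namespace, so that its registered stubs `stub_ujDefectIdentity` (★),
`stub_ujContourVsFlux` (★★), `stub_ujDefectCancellation` (B2) mention ONE copy of each object. Nothing is
asserted; the only theorem is the elementary `exists_shiftMatches` (registered glue sub-goal carrying this
section). Sources: V. Beffara, *Is critical 2D percolation universal?* (2008) §3 eq. (discr), §4;
B. Bollobás, O. Riordan, *Percolation* (2006) Ch. 7, Lemma 13 p. 181 ((13), (15)–(17)). -/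

namespace Summit.CriticalPhenomena.CardyFormulaZ2.Cruxes.UnionJackMorera.DefectSum

/-- **Rotation defect** of the oriented edge `(t, j)` of `T_s` (balanced centres `ujFaceCenter`),
shift `k` (`k = 1`: anticlockwise data, `ω = ζ²`; `k = 2`: clockwise, `ω = ζ̄²`):
`Ψ_k(t, j) = (c(n_{j+k} t) − c t) − ω (c(n_j t) − c t)`. The honeycomb analogue vanishes
identically (Bollobás–Riordan (13), p. 181); this one does not (Beffara's `ψ ≠ 0`). A definition of the
line `defect_sum`, not a fact. -/
def ujRotDefect (ω : ℂ) (k : Fin 3) (t : UJFace) (j : Fin 3) : ℂ :=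
  (ujFaceCenter (ujFaceNbr t (j + k)) - ujFaceCenter t) -
    ω * (ujFaceCenter (ujFaceNbr t j) - ujFaceCenter t)

/-- The triangles of `δ · T_s` whose scaled balanced centre lies in the plane set `A`. -/
def ujFacesIn (δ : ℝ) (A : Set ℂ) : Set UJFace :=
  {t | (δ : ℂ) * ujFaceCenter t ∈ A}

/-- **Interior defect sum** over the faces in `A`: `Σ_t Σ_j δ Ψ_k(t, j) h^i_δ(t, n_j t)` with
`h^i_δ(t, n_j t) = ujEdgePatternProb` — Beffara's `Σ_e ψ(e) P_{A,δ}(e)` in the tree's normalisation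
(`finsum`: the face set is finite for bounded `A`, `δ ≠ 0`). -/
def ujDefectSum (D : MarkedDomain 3) (δ : ℝ) (ω : ℂ) (k : Fin 3) (i : Fin 3) (A : Set ℂ) : ℂ :=
  ∑ᶠ t ∈ ujFacesIn δ A, ∑ j : Fin 3,
    (δ : ℂ) * ujRotDefect ω k t j * (ujEdgePatternProb D δ i t j : ℂ)

open Classical in
/-- **Boundary flux sum** of `H^i_δ = ujSepProb` out of `A`: over the dual edges `(t, j)` with `t`
inside and `n_j t` outside, `δ (c(n_j t) − c t) · H^i_δ(t)` — the boundary part left by the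
summation by parts when the balance `Σ_j (c(n_j t) − c t) = 0` replaces (13). (Classical `if`, as in
the skeleton, which works under `open Classical`.) -/
def ujBdrySum (D : MarkedDomain 3) (δ : ℝ) (i : Fin 3) (A : Set ℂ) : ℂ :=
  ∑ᶠ t ∈ ujFacesIn δ A, ∑ j : Fin 3,
    (if ujFaceNbr t j ∈ ujFacesIn δ A then (0 : ℂ)
      else (δ : ℂ) * (ujFaceCenter (ujFaceNbr t j) - ujFaceCenter t) * (ujSepProb D δ i t : ℂ))

/-- The closed solid lattice triangle of the contour `p → p + n s → p + n s ζ → p` (the set over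
which `IsSeparatingData.cauchy` quantifies, by name). -/
def solidTriangle (p : ℂ) (s : ℝ) (n : ℕ) : Set ℂ :=
  convexHull ℝ {p, p + n * s, p + n * s * triZeta}

/-- Orientation bookkeeping: the shift `k` matching the root of unity of the Carleson datum. -/
def ShiftMatches (a b c : ℂ) (k : Fin 3) : Prop :=
  (k = 1 ∧ triangleTurn a b c = triZeta ^ 2) ∨ (k = 2 ∧ triangleTurn a b c = starRingEnd ℂ (triZeta ^ 2))

/-- **Every Carleson datum has a matching shift** (`triangleTurn_eq_or_of_isEquilateral`: the turn of a
non-degenerate equilateral triangle is `ζ²` or `ζ̄²`). Registered glue sub-goal of crux `UnionJackMorera`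
carrying this section. -/
theorem exists_shiftMatches : ∀ {a b c : ℂ}, IsEquilateral a b c → ∃ k : Fin 3, ShiftMatches a b c k := by
  intro a b c h
  rcases triangleTurn_eq_or_of_isEquilateral h with h1 | h2
  · exact ⟨1, Or.inl ⟨rfl, h1⟩⟩
  · exact ⟨2, Or.inr ⟨rfl, h2⟩⟩

/-! ### The summation-by-parts vocabulary of Lemma 13 on `T_s` (lead c1, reshape of stub ★)

Bollobás–Riordan's proof of Lemma 13 (p. 181, (15)–(17)) manipulates the **interior pair sum**
`S^i = Σ_{z ∈ A} Σ_j (z_j − z) hⁱ(z, z_j)` over the faces inside the contour: by (10) and the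
antisymmetry of `z_j − z` on interior pairs it equals the boundary flux of `Hⁱ` plus the pairs
reaching out of `A` ((15)–(16)); by colour switching (14) and the rotation (13) `S^{i+1} = ω S^i`
((17)). On `T_s` the rotation (13) fails and is replaced by the defect `Ψ_k`; the three objects below
(the pair sum, its outer boundary part, and the colour-switching defect) let the registered stub ★
`stub_ujDefectIdentity` be cut into two EXACT finite identities (`ujPairSum = ujBdrySum + ujOutSum`,
`ujPairSum (i+1) − ω ujPairSum i − ujDefectSum = ujSwitchDefect`) and two named probabilistic inputs
(exact switching at interior faces: `ujSwitchDefect = 0`; one-arm smallness of `ujOutSum`). Nothing is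
asserted; the only theorems are the elementary `ujSwitchDefect_eq_zero_of_switching` (registered glue
sub-goal carrying this section) and its companions. Sources: B. Bollobás, O. Riordan, *Percolation*
(2006) Ch. 7, Lemma 13 p. 181 ((14)–(17)); V. Beffara (2008) §3 eq. (discr), (swapping). -/

/-- **Interior pair sum** `S^i_δ(A) = Σ_{t ∈ A} Σ_j δ (c(n_j t) − c t) · hⁱ_δ(t, n_j t)` over ALL
oriented edges `(t, j)` of `T_s` out of the faces in `A` (Bollobás–Riordan's `Σ_z Σ_j (z_j − z) h(z, z_j)`
of (15), p. 181, with `h(t, n_j t) = ujEdgePatternProb`). A definition of the line `defect_sum`, not a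
fact. -/
def ujPairSum (D : MarkedDomain 3) (δ : ℝ) (i : Fin 3) (A : Set ℂ) : ℂ :=
  ∑ᶠ t ∈ ujFacesIn δ A, ∑ j : Fin 3,
    (δ : ℂ) * (ujFaceCenter (ujFaceNbr t j) - ujFaceCenter t) * (ujEdgePatternProb D δ i t j : ℂ)

open Classical in
/-- **Outer boundary-pair sum**: the part of `ujPairSum` over the oriented edges `(t, j)` with `t`
inside `A` and `n_j t` outside, `δ (c(n_j t) − c t) · hⁱ_δ(t, n_j t)` — the term of (16), p. 181,
bounded there by the one-arm estimate (12) times the number of boundary edges. A definition of the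
line `defect_sum`, not a fact. -/
def ujOutSum (D : MarkedDomain 3) (δ : ℝ) (i : Fin 3) (A : Set ℂ) : ℂ :=
  ∑ᶠ t ∈ ujFacesIn δ A, ∑ j : Fin 3,
    (if ujFaceNbr t j ∈ ujFacesIn δ A then (0 : ℂ)
      else (δ : ℂ) * (ujFaceCenter (ujFaceNbr t j) - ujFaceCenter t) *
        (ujEdgePatternProb D δ i t j : ℂ))

/-- **Colour-switching defect** of shift `k`:
`Σ_{t ∈ A} Σ_j δ (c(n_{j+k} t) − c t) · (h^{i+1}_δ(t, n_{j+k} t) − hⁱ_δ(t, n_j t))` — the exact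
remainder of `S^{i+1} − ω S^i − DefectSum^k_i` (reindex `j ↦ j + k` in `S^{i+1}`); it vanishes as
soon as Smirnov's colour switching `h^{i+1}(t, n_{j+k} t) = hⁱ(t, n_j t)` (Bollobás–Riordan (14) /
Lemma 12; Beffara (swapping)) holds at every face of `A` (`ujSwitchDefect_eq_zero_of_switching`).
A definition of the line `defect_sum`, not a fact. -/
def ujSwitchDefect (D : MarkedDomain 3) (δ : ℝ) (k : Fin 3) (i : Fin 3) (A : Set ℂ) : ℂ :=
  ∑ᶠ t ∈ ujFacesIn δ A, ∑ j : Fin 3,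
    (δ : ℂ) * (ujFaceCenter (ujFaceNbr t (j + k)) - ujFaceCenter t) *
      ((ujEdgePatternProb D δ (i + 1) t (j + k) : ℂ) - (ujEdgePatternProb D δ i t j : ℂ))

/-- **Exact colour switching at the faces of `A` kills the switching defect**: if
`h^{i+1}_δ(t, n_{j+k} t) = hⁱ_δ(t, n_j t)` for every `t ∈ A` and every `j` (Bollobás–Riordan (14),
p. 181) then `ujSwitchDefect D δ k i A = 0` (every summand vanishes). Registered glue sub-goal of
crux `UnionJackMorera` carrying this section. -/
theorem ujSwitchDefect_eq_zero_of_switching : ∀ {D : MarkedDomain 3} {δ : ℝ} {k i : Fin 3} {A : Set ℂ}, (∀ t ∈ ujFacesIn δ A, ∀ j : Fin 3, ujEdgePatternProb D δ (i + 1) t (j + k) = ujEdgePatternProb D δ i t j) → ujSwitchDefect D δ k i A = 0 := by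
  intro D δ k i A h
  unfold ujSwitchDefect
  refine finsum_mem_of_eqOn_zero fun t ht => ?_
  simp only [Pi.zero_apply]
  refine Finset.sum_eq_zero fun j _ => ?_
  rw [h t ht j, sub_self, mul_zero]

/-- Membership in `ujFacesIn`, unfolded. -/
theorem mem_ujFacesIn_iff {δ : ℝ} {A : Set ℂ} {t : UJFace} :
    t ∈ ujFacesIn δ A ↔ (δ : ℂ) * ujFaceCenter t ∈ A :=
  Iff.rfl

/-- The square of a triangle is read off its balanced centre: for `t = ((a, b), s)`,
`a` is within `1/4` of `Re c(t) − Im c(t)` and `b + 1` within `1/4` of `Re c(t) + Im c(t)` (the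
centre of the square `(a, b)` is `((a + b + 1) + (b + 1 − a) i)/2`, and the balanced centre of the
triangle is at distance `√2/8` from it). -/
theorem abs_sq_sub_ujFaceCenter_frame_le (t : UJFace) :
    |(t.1.1 : ℝ) - ((ujFaceCenter t).re - (ujFaceCenter t).im)| ≤ 1 / 4 ∧
      |(t.1.2 : ℝ) + 1 - ((ujFaceCenter t).re + (ujFaceCenter t).im)| ≤ 1 / 4 := by
  obtain ⟨⟨a, b⟩, s⟩ := t
  fin_cases s <;>
    simp [ujFaceCenter, ujFaceVert, ujCorner, unionJackEmbed] <;> ring_nf <;> norm_num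

/-- **Bounded plane sets meet finitely many scaled triangles**: for `δ ≠ 0` and bounded `A` the
face set `ujFacesIn δ A` is finite (its triangles lie in finitely many squares). This makes the
`finsum`s of the line honest finite sums on solid triangles. -/
theorem ujFacesIn_finite {δ : ℝ} (hδ : δ ≠ 0) {A : Set ℂ} (hA : Bornology.IsBounded A) :
    (ujFacesIn δ A).Finite := by
  obtain ⟨R, hR⟩ := hA.subset_closedBall 0
  have hδpos : 0 < |δ| := abs_pos.2 hδ
  obtain ⟨N, hN⟩ := exists_nat_ge (2 * (R / |δ|) + 2)
  -- every face in `ujFacesIn δ A` has its square in the box `[-N, N]²`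
  have hbox : ∀ t ∈ ujFacesIn δ A,
      t ∈ (((Finset.Icc (-(N : ℤ)) N ×ˢ Finset.Icc (-(N : ℤ)) N) ×ˢ
        (Finset.univ : Finset (Fin 4)) : Finset UJFace) : Set UJFace) := by
    intro t ht
    rw [mem_ujFacesIn_iff] at ht
    have h1 : ‖(δ : ℂ) * ujFaceCenter t‖ ≤ R := by simpa using hR ht
    have h2 : ‖ujFaceCenter t‖ ≤ R / |δ| := by
      rw [norm_mul, Complex.norm_real, Real.norm_eq_abs] at h1
      rw [le_div_iff₀ hδpos, mul_comm]; exact h1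
    have hre : |(ujFaceCenter t).re| ≤ R / |δ| := (Complex.abs_re_le_norm _).trans h2
    have him : |(ujFaceCenter t).im| ≤ R / |δ| := (Complex.abs_im_le_norm _).trans h2
    obtain ⟨ha, hb⟩ := abs_sq_sub_ujFaceCenter_frame_le t
    rw [abs_le] at hre him ha hb
    have ha' : |(t.1.1 : ℝ)| ≤ N := by
      rw [abs_le]; constructor <;> linarith [hre.1, hre.2, him.1, him.2, ha.1, ha.2]
    have hb' : |(t.1.2 : ℝ)| ≤ N := by
      rw [abs_le]; constructor <;> linarith [hre.1, hre.2, him.1, him.2, hb.1, hb.2]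
    rw [abs_le] at ha' hb'
    have e1 : -(N : ℤ) ≤ t.1.1 := by exact_mod_cast ha'.1
    have e2 : t.1.1 ≤ (N : ℤ) := by exact_mod_cast ha'.2
    have e3 : -(N : ℤ) ≤ t.1.2 := by exact_mod_cast hb'.1
    have e4 : t.1.2 ≤ (N : ℤ) := by exact_mod_cast hb'.2
    simp only [Finset.coe_product, Finset.coe_Icc, Finset.coe_univ, Set.mem_prod, Set.mem_Icc,
      Set.mem_univ, and_true]
    exact ⟨⟨e1, e2⟩, e3, e4⟩
  exact Set.Finite.subset (Finset.finite_toSet _) hbox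

end Summit.CriticalPhenomena.CardyFormulaZ2.Cruxes.UnionJackMorera.DefectSum

end
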